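import Mathlib
import Summits.ValiantsHypothesis.ValiantsHypothesis.Theses.ElementaryWordLength
import Summits.ValiantsHypothesis.ValiantsHypothesis.Theorems.ElementaryWordLengthWordPerSuperQuarticStubWordSubst
import Summits.ValiantsHypothesis.ValiantsHypothesis.Theorems.ElementaryWordLengthWordPerSuperQuarticStubBlockTransport
import Summits.ValiantsHypothesis.ValiantsHypothesis.Theorems.ElementaryWordLengthWordPerSuperQuarticStubBlockCount
import Summits.ValiantsHypothesis.ValiantsHypothesis.Theorems.ElementaryWordLengthWordPerSuperQuarticStubArith

/-!
# Crux `ElementaryWordLength.WordPerSuperQuartic` (stmt-ValiantsHypothesis-6624), line `Sketch`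
# (idea `signature-noncontainment`): the complete glue **block hardness ⇒ the crux**

This file proves, sorry-free, the whole composition of line `Sketch`
(`Cruxes/WordPerSuperQuartic/Lines/Sketch.lean`) as an implication from its one open stub:

* `wordPerSuperQuartic_of_blockHardness : C⁺ → WordPerSuperQuartic` — if for some `ε > 0` and all
  large `n` there are a block size `b` (`0 < b`, `2b ≤ n`) and complex values `x` for the off-block
  variables such that every affine elementary word whose variable letters read only the diagonal block
  `D_b = {x_ii : i < b}` and whose matrix is `E_02(per_n|_{x off D_b})` has more than `2b·n^(2+ε)`
  variable letters (C⁺, "block hardness", the card's `BlockGenericity` in the route's own word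
  vocabulary), then every affine elementary word for `E_02(per_n)` has length `≥ n^(4+ε)` — the crux,
  with the SAME `ε`;
* `wordPerSuperQuartic_of_halfDiagonalHardness` — the linear-scale instance `b = n/2` (C⁺-lin: the
  half-diagonal pencil `per(A_x + diag(x_00, …, x_{b-1,b-1}, 0, …, 0))` needs `> n·n^(2+ε)` block letters)
  already implies the crux.

Proof of the glue (elementary; per's symmetry + restriction + counting): `per_n` is invariant under
independent row/column permutations (`rename_prodMap_perPoly_eq`), renaming every letter renames the
word's matrix (`rename_wordProd`), so each of the `n·(n/b)` pairwise disjoint shifted blocks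
`S_{k,c} = {(r, r+k) : cb ≤ r < (c+1)b}` is carried onto `D_b` (`stub_blockTransport`, landed); freezing
the off-block variables at `x` (`stub_wordSubst`, landed) turns the word into a block word for the block
restriction, whose variable letters are exactly the `S_{k,c}`-letters of the original word, hence number
`> 2b·n^(2+ε)` by C⁺; the block letter counts sum to at most `|w|` (`stub_blockCount`, landed) and
`n·(n/b)·2b·n^(2+ε) ≥ n^(4+ε)` (`stub_arith`, landed).

What is NOT here: a proof of C⁺.  C⁺ is the line's stub S1, held by the lead; at every admissible scale
it asks for a factor `≈ n^ε·log n` beyond the transcendence count (see `Cruxes/WordPerSuperQuartic/NOTES.md`),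
i.e. it is crux-sized, and this file records the reduction so that it is durable independently of S1.
References: Ben-Or–Cleve 1992 (the word model); Nechiporuk 1966 / Kalorkoti 1985 (block restriction
counting, the method C⁺ must exceed).
-/

noncomputable section

-- `Summit.ValiantsHypothesis.ValiantsHypothesis.…` is the tree's mandated single-conjunct layout.
set_option linter.dupNamespace false

namespace Summit.ValiantsHypothesis.ValiantsHypothesis.Theorems.WordPerSuperQuartic

open Literature.Computability.AlgebraicComplexity MvPolynomial

/-! ## Glue lemmas: renaming, substitution, counting through a renaming -/

/-- `per` is invariant under independent row and column permutations of the variables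
(`per (P X Q) = per X` for permutation matrices). -/
theorem rename_prodMap_perPoly_eq {T : Type*} [Fintype T] [DecidableEq T] (K : Type*)
    [CommRing K] (ρ γ : Equiv.Perm T) :
    rename (Prod.map ρ γ) (perPoly T K) = perPoly T K := by
  have h1 : rename (Prod.map ρ γ) (perPoly T K) =
      ((Matrix.mvPolynomialX T T K).submatrix ρ γ).permanent := by
    simp only [perPoly, Matrix.permanent, map_sum, map_prod, Matrix.mvPolynomialX_apply, rename_X,
      Matrix.submatrix_apply, Prod.map_apply]
  rw [h1]
  have h2 : ((Matrix.mvPolynomialX T T K).submatrix (ρ : T → T) (γ : T → T)) =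
      (((Matrix.mvPolynomialX T T K).submatrix id (γ : T → T)).submatrix (ρ : T → T) id) := by
    ext i j; simp
  rw [h2, Matrix.permanent_permute_cols, Matrix.permanent_permute_rows]
  rfl

/-- Functoriality of transvections under an entrywise ring homomorphism. -/
theorem transvection_map {m R S : Type*} [DecidableEq m] [Fintype m] [CommRing R] [CommRing S]
    (f : R →+* S) (i j : m) (c : R) :
    (Matrix.transvection i j c).map f = Matrix.transvection i j (f c) := by
  ext k l
  simp only [Matrix.transvection, Matrix.map_apply, Matrix.add_apply, Matrix.one_apply,
    Matrix.single_apply]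
  split_ifs <;> simp

/-- An entrywise ring homomorphism maps the matrix of a word to the product of the mapped
letters. -/
theorem mapMatrix_wordProd {σ R S : Type*} [CommRing R] [CommRing S]
    (f : MvPolynomial σ R →+* S) (w : List (Fin 3 × Fin 3 × R × Option σ)) :
    f.mapMatrix (w.map (fun l => Matrix.transvection l.1 l.2.1
        (C l.2.2.1 * l.2.2.2.elim 1 X))).prod =
      (w.map (fun l => Matrix.transvection l.1 l.2.1
        (f (C l.2.2.1) * l.2.2.2.elim 1 (fun v => f (X v))))).prod := by
  rw [map_list_prod, List.map_map]
  congr 1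
  apply List.map_congr_left
  intro l _
  simp only [Function.comp_apply, RingHom.mapMatrix_apply, transvection_map, map_mul]
  congr 2
  cases l.2.2.2 <;> simp

/-- Renaming the variable of every letter renames the word's matrix entrywise. -/
theorem rename_wordProd {σ τ R : Type*} [CommRing R] (e : σ → τ)
    (w : List (Fin 3 × Fin 3 × R × Option σ)) :
    ((w.map (fun l => (l.1, l.2.1, l.2.2.1, l.2.2.2.map e))).map
        (fun l => Matrix.transvection l.1 l.2.1
          (C l.2.2.1 * l.2.2.2.elim 1 X : MvPolynomial τ R))).prod =
      (rename e).toRingHom.mapMatrix (w.map (fun l => Matrix.transvection l.1 l.2.1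
        (C l.2.2.1 * l.2.2.2.elim 1 X))).prod := by
  rw [mapMatrix_wordProd, List.map_map]
  congr 1
  apply List.map_congr_left
  intro l _
  simp only [Function.comp_apply, AlgHom.toRingHom_eq_coe, RingHom.coe_coe, rename_C, rename_X]
  congr 2
  cases l.2.2.2 <;> simp

/-- A ring homomorphism applied entrywise to `E_02(f)` gives `E_02` of the image. -/
theorem mapMatrix_transvection {R S : Type*} [CommRing R] [CommRing S] (f : R →+* S)
    (i j : Fin 3) (c : R) :
    f.mapMatrix (Matrix.transvection i j c) = Matrix.transvection i j (f c) := by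
  rw [RingHom.mapMatrix_apply, transvection_map]

/-- Counting letters through a renaming of the variables. -/
theorem countP_map_rename {σ τ : Type} (e : σ → τ) (P : τ → Bool)
    (w : List (Fin 3 × Fin 3 × ℂ × Option σ)) :
    (w.map (fun l => (l.1, l.2.1, l.2.2.1, l.2.2.2.map e))).countP (fun l => l.2.2.2.any P) =
      w.countP (fun l => l.2.2.2.any (fun v => P (e v))) := by
  rw [List.countP_map]
  congr 1
  funext l
  simp only [Function.comp_apply]
  cases l.2.2.2 <;> simp

/-- The substituted word keeps `i ≠ j` on every letter. -/
theorem subst_offDiag {σ : Type} (p : σ → Prop) [DecidablePred p] (x : σ → ℂ)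
    (w : List (Fin 3 × Fin 3 × ℂ × Option σ)) (hw : ∀ l ∈ w, l.1 ≠ l.2.1) :
    ∀ l ∈ (w.map (fun l => if l.2.2.2.any (fun v => decide (p v)) then l
        else (l.1, l.2.1, l.2.2.1 * l.2.2.2.elim 1 x, none))), l.1 ≠ l.2.1 := by
  intro l hl
  obtain ⟨l₀, hl₀, rfl⟩ := List.mem_map.1 hl
  have h := hw l₀ hl₀
  split_ifs <;> simpa using h

/-- Every variable letter of the substituted word reads a block variable. -/
theorem subst_vars {σ : Type} (p : σ → Prop) [DecidablePred p] (x : σ → ℂ)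
    (w : List (Fin 3 × Fin 3 × ℂ × Option σ)) :
    ∀ l ∈ (w.map (fun l => if l.2.2.2.any (fun v => decide (p v)) then l
        else (l.1, l.2.1, l.2.2.1 * l.2.2.2.elim 1 x, none))), ∀ v, l.2.2.2 = some v → p v := by
  intro l hl v hv
  obtain ⟨l₀, _, rfl⟩ := List.mem_map.1 hl
  by_cases h : l₀.2.2.2.any (fun v => decide (p v)) = true
  · rw [if_pos h] at hv
    rw [hv] at h
    simpa using h
  · rw [if_neg h] at hv
    simp at hv

/-- The variable letters of the substituted word are the block letters of the original. -/
theorem subst_countP {σ : Type} (p : σ → Prop) [DecidablePred p] (x : σ → ℂ)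
    (w : List (Fin 3 × Fin 3 × ℂ × Option σ)) :
    (w.map (fun l => if l.2.2.2.any (fun v => decide (p v)) then l
        else (l.1, l.2.1, l.2.2.1 * l.2.2.2.elim 1 x, none))).countP (fun l => l.2.2.2.isSome) =
      w.countP (fun l => l.2.2.2.any (fun v => decide (p v))) := by
  rw [List.countP_map]
  congr 1
  funext l
  simp only [Function.comp_apply]
  by_cases h : l.2.2.2.any (fun v => decide (p v)) = true
  · rw [if_pos h, h]
    revert h
    cases l.2.2.2 <;> simp
  · rw [if_neg h]
    simp only [Option.isSome_none]
    revert h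
    cases l.2.2.2 <;> simp

/-! ## Block hardness implies the crux -/

/-- **Block hardness ⇒ `WordPerSuperQuartic`** (line `Sketch`, the whole glue, with the `ε` of C⁺):
each of the `n · (n/b)` disjoint shifted blocks is moved onto the diagonal block by row and column
permutations (`stub_blockTransport`; `per_n` is invariant, the word is renamed letter by letter), the
off-block variables are frozen at the hard point `x` (`stub_wordSubst`), so its letters number more
than `2b·n^(2+ε)` (hypothesis C⁺); summing over the blocks (`stub_blockCount`) and `(n/b)·b ≥ n/2`
(`stub_arith`) give `n^(4+ε) ≤ |w|`. [folklore] -/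
theorem wordPerSuperQuartic_of_blockHardness
    (hC : ∃ ε : ℝ, 0 < ε ∧ ∃ n₀ : ℕ, ∀ n ≥ n₀, ∃ b : ℕ, 0 < b ∧ 2 * b ≤ n ∧
      ∃ x : Fin n × Fin n → ℂ, ∀ w : List (Fin 3 × Fin 3 × ℂ × Option (Fin n × Fin n)),
        (∀ l ∈ w, l.1 ≠ l.2.1) →
        (∀ l ∈ w, ∀ v, l.2.2.2 = some v → v.1 = v.2 ∧ (v.1 : ℕ) < b) →
        (w.map (fun l => Matrix.transvection l.1 l.2.1
            (C l.2.2.1 * l.2.2.2.elim 1 X))).prod =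
          Matrix.transvection (0 : Fin 3) 2
            (aeval (fun v : Fin n × Fin n =>
              if v.1 = v.2 ∧ (v.1 : ℕ) < b then X v else C (x v)) (perPoly (Fin n) ℂ)) →
        2 * (b : ℝ) * (n : ℝ) ^ (2 + ε) < (w.countP (fun l => l.2.2.2.isSome) : ℝ)) :
    Summit.ValiantsHypothesis.ValiantsHypothesis.Theses.ElementaryWordLength.WordPerSuperQuartic := by
  obtain ⟨ε, hε, n₀, hC⟩ := hC
  refine ⟨ε, hε, n₀, fun n hn L hex => ?_⟩
  obtain ⟨w, hlen, hw, hprod⟩ := hex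
  obtain ⟨b, hb, h2b, x, hx⟩ := hC n hn
  -- the block predicate and the per-block bound
  have hblock : ∀ (k : Fin n) (c : ℕ), c < n / b →
      2 * (b : ℝ) * (n : ℝ) ^ (2 + ε) <
        (w.countP (fun l => l.2.2.2.any (fun v =>
          decide (v.2 = v.1 + k ∧ c * b ≤ (v.1 : ℕ) ∧ (v.1 : ℕ) < (c + 1) * b))) : ℝ) := by
    intro k c hc
    have hcb : (c + 1) * b ≤ n := by
      have h1 : c + 1 ≤ n / b := hc
      calc (c + 1) * b ≤ (n / b) * b := Nat.mul_le_mul_right b h1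
        _ ≤ n := Nat.div_mul_le_self n b
    obtain ⟨ρ, γ, hS⟩ := stub_blockTransport n b c k hcb
    -- Step 1: rename the word by `e = ρ × γ`.
    let e : Fin n × Fin n → Fin n × Fin n := Prod.map ρ γ
    let w₁ : List (Fin 3 × Fin 3 × ℂ × Option (Fin n × Fin n)) :=
      w.map (fun l => (l.1, l.2.1, l.2.2.1, l.2.2.2.map e))
    have hw₁ : ∀ l ∈ w₁, l.1 ≠ l.2.1 := by
      intro l hl
      obtain ⟨l₀, hl₀, rfl⟩ := List.mem_map.1 hl
      exact hw l₀ hl₀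
    have hprod₁ : (w₁.map (fun l => Matrix.transvection l.1 l.2.1
        (C l.2.2.1 * l.2.2.2.elim 1 X))).prod =
          Matrix.transvection (0 : Fin 3) 2 (perPoly (Fin n) ℂ) := by
      rw [rename_wordProd, hprod, mapMatrix_transvection]
      simp only [AlgHom.toRingHom_eq_coe, RingHom.coe_coe]
      rw [rename_prodMap_perPoly_eq]
    -- Step 2: freeze the off-block variables at `x`.
    let p : Fin n × Fin n → Prop := fun v => v.1 = v.2 ∧ (v.1 : ℕ) < b
    let w₂ : List (Fin 3 × Fin 3 × ℂ × Option (Fin n × Fin n)) :=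
      w₁.map (fun l => if l.2.2.2.any (fun v => decide (p v)) then l
        else (l.1, l.2.1, l.2.2.1 * l.2.2.2.elim 1 x, none))
    have hw₂ : ∀ l ∈ w₂, l.1 ≠ l.2.1 := subst_offDiag p x w₁ hw₁
    have hv₂ : ∀ l ∈ w₂, ∀ v, l.2.2.2 = some v → v.1 = v.2 ∧ (v.1 : ℕ) < b :=
      subst_vars p x w₁
    have hprod₂ : (w₂.map (fun l => Matrix.transvection l.1 l.2.1
        (C l.2.2.1 * l.2.2.2.elim 1 X))).prod =
          Matrix.transvection (0 : Fin 3) 2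
            (aeval (fun v : Fin n × Fin n =>
              if v.1 = v.2 ∧ (v.1 : ℕ) < b then X v else C (x v)) (perPoly (Fin n) ℂ)) := by
      show ((w₁.map _).map _).prod = _
      rw [stub_wordSubst p x w₁, hprod₁, mapMatrix_transvection]
      rfl
    have hcount := hx w₂ hw₂ hv₂ hprod₂
    -- Step 3: the variable letters of `w₂` are the `S_{k,c}`-letters of `w`.
    have hc₂ : w₂.countP (fun l => l.2.2.2.isSome) =
        w.countP (fun l => l.2.2.2.any (fun v =>
          decide (v.2 = v.1 + k ∧ c * b ≤ (v.1 : ℕ) ∧ (v.1 : ℕ) < (c + 1) * b))) := by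
      show (w₁.map _).countP _ = _
      rw [subst_countP p x w₁]
      show (w.map _).countP _ = _
      rw [countP_map_rename]
      congr 1
      funext l
      congr 1
      funext v
      simp only [p, e, Prod.map_fst, Prod.map_snd, decide_eq_decide]
      exact hS v
    rw [hc₂] at hcount
    exact hcount
  -- Step 4: sum over the blocks.
  have hsum : (n : ℝ) * (n / b : ℕ) * (2 * (b : ℝ) * (n : ℝ) ^ (2 + ε)) ≤ (L : ℝ) := by
    have h1 : ∑ k : Fin n, ∑ c ∈ Finset.range (n / b), (2 * (b : ℝ) * (n : ℝ) ^ (2 + ε)) ≤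
        ∑ k : Fin n, ∑ c ∈ Finset.range (n / b),
          (w.countP (fun l => l.2.2.2.any (fun v =>
            decide (v.2 = v.1 + k ∧ c * b ≤ (v.1 : ℕ) ∧ (v.1 : ℕ) < (c + 1) * b))) : ℝ) := by
      refine Finset.sum_le_sum fun k _ => Finset.sum_le_sum fun c hc => ?_
      exact (hblock k c (Finset.mem_range.1 hc)).le
    have h2 := stub_blockCount n b (n / b) w
    have h3 : ((∑ k : Fin n, ∑ c ∈ Finset.range (n / b),
          w.countP (fun l => l.2.2.2.any (fun v =>
            decide (v.2 = v.1 + k ∧ c * b ≤ (v.1 : ℕ) ∧ (v.1 : ℕ) < (c + 1) * b))) : ℕ) : ℝ) ≤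
        (L : ℝ) := by
      exact_mod_cast h2.trans hlen
    rw [Finset.sum_const, Finset.sum_const, Finset.card_univ, Fintype.card_fin,
      Finset.card_range] at h1
    simp only [nsmul_eq_mul] at h1
    push_cast at h3
    linarith
  exact stub_arith n b L ε hb h2b hsum


/-- **The linear-scale instance C⁺-lin already gives the crux.**  If for some `ε > 0` and all large
`n` there are off-block values `x` such that every block word for the half-diagonal pencil (variable
letters confined to `{x_ii : i < n/2}`, matrix `E_02(per_n|_{x off the half diagonal})`) has more than
`n · n^(2+ε)` variable letters, then `WordPerSuperQuartic` holds (take `b = n/2` in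
`wordPerSuperQuartic_of_blockHardness`: `2·(n/2) ≤ n`). [folklore] -/
theorem wordPerSuperQuartic_of_halfDiagonalHardness
    (hC : ∃ ε : ℝ, 0 < ε ∧ ∃ n₀ : ℕ, ∀ n ≥ n₀,
      ∃ x : Fin n × Fin n → ℂ, ∀ w : List (Fin 3 × Fin 3 × ℂ × Option (Fin n × Fin n)),
        (∀ l ∈ w, l.1 ≠ l.2.1) →
        (∀ l ∈ w, ∀ v, l.2.2.2 = some v → v.1 = v.2 ∧ (v.1 : ℕ) < n / 2) →
        (w.map (fun l => Matrix.transvection l.1 l.2.1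
            (C l.2.2.1 * l.2.2.2.elim 1 X))).prod =
          Matrix.transvection (0 : Fin 3) 2
            (aeval (fun v : Fin n × Fin n =>
              if v.1 = v.2 ∧ (v.1 : ℕ) < n / 2 then X v else C (x v)) (perPoly (Fin n) ℂ)) →
        (n : ℝ) * (n : ℝ) ^ (2 + ε) < (w.countP (fun l => l.2.2.2.isSome) : ℝ)) :
    Summit.ValiantsHypothesis.ValiantsHypothesis.Theses.ElementaryWordLength.WordPerSuperQuartic := by
  obtain ⟨ε, hε, n₀, hC⟩ := hC
  refine wordPerSuperQuartic_of_blockHardness ⟨ε, hε, max n₀ 2, fun n hn => ?_⟩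
  have hn₀ : n₀ ≤ n := le_trans (le_max_left _ _) hn
  have hn2 : 2 ≤ n := le_trans (le_max_right _ _) hn
  obtain ⟨x, hx⟩ := hC n hn₀
  refine ⟨n / 2, Nat.div_pos hn2 two_pos, Nat.mul_div_le n 2, x, fun w hw hv hprod => ?_⟩
  have h := hx w hw hv hprod
  have hb : 2 * ((n / 2 : ℕ) : ℝ) ≤ (n : ℝ) := by exact_mod_cast Nat.mul_div_le n 2
  have hpow : (0 : ℝ) ≤ (n : ℝ) ^ (2 + ε) := Real.rpow_nonneg (Nat.cast_nonneg n) _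
  calc 2 * ((n / 2 : ℕ) : ℝ) * (n : ℝ) ^ (2 + ε) ≤ (n : ℝ) * (n : ℝ) ^ (2 + ε) :=
        mul_le_mul_of_nonneg_right hb hpow
    _ < _ := h

end Summit.ValiantsHypothesis.ValiantsHypothesis.Theorems.WordPerSuperQuartic

end
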